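import Mathlib
import HarnessLib
import Summits.Langlands.Langlands.Theses.SkinnerWilesDefectOne
import Literature.NumberTheory.Automorphic.IsAutomorphicAE
import Literature.NumberTheory.GaloisRepresentations.ResidualGaloisRep
import Literature.NumberTheory.GaloisRepresentations.EnormousSubgroup
import Literature.NumberTheory.GaloisRepresentations.DecomposedGeneric

/-!
# Sketch for the crux idea `smith-ascent-torsion-seed` (crux stmt-Langlands-12921,
`SkinnerWilesDefectOne.ProModularOrdinaryClassical`; crux-ideate round 2, ideator 4)

Elaboration-only sketch of the idea's First lemma(s):

* `HasTorsionSeed p ρ` — the ONE thing pro-modularity (`hpm`) carries that Fontaine–Mazur does not: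
  a RESIDUAL (mod-`p`, torsion, any level, any degree) automorphic seed: a residual representation of `ρ`
  is associated with a continuous eigensystem of the completed-cohomology Hecke algebra with values in a
  DISCRETE field of characteristic `p`.
* `torsionSeed_of_proMod` (S1, formal given Borel–Serre finiteness): `hpm → HasTorsionSeed`.
* `SmithAscentModP` (S2, THE LEVER — Treumann–Venkatesh, Ann. of Math. 183 (2016), First Main Theorem =
  Thm 5 of §5, their own example "cyclic base change … even for `H = SL₂` and `F = ℚ(i)` … applies to
  characteristic `p` torsion classes"): along a CYCLIC extension `F'/F` of degree EXACTLY `p` (= the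
  coefficient characteristic) torsion seeds ascend: `HasTorsionSeed p ρ → HasTorsionSeed p (ρ|_{Γ_{F'}})`.
* `GenericCrystallineRegime`, `SmithAscentClassical` — the regime theorem the line proves (crux restricted
  to: `p ≥ 5` split in `F`, `m = 1` (crystalline ordinary), `2k < p`, `ρ̄` Taylor–Wiles generic,
  residually NON-SPLIT above `p`, ramification-generic away from `p`), and `smithAscentClassical_of_crux`:
  it is VERBATIM a specialisation of the crux (costume check: weaker, not stronger).
-/

namespace Summit.Langlands.Langlands.Cruxes.ProModularOrdinaryClassical.SmithAscent

set_option linter.dupNamespace false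
set_option linter.unusedVariables false

open scoped NumberField MatrixGroups
open Filter NumberField IsDedekindDomain Field
open Literature.NumberTheory.Automorphic Literature.NumberTheory.Automorphic.BigHeckeGLn
open Literature.NumberTheory.GaloisRepresentations
open Summit.Langlands.Langlands.Theses.SkinnerWilesDefectOne

noncomputable section

variable {F : Type} [Field F] [NumberField F] (p : ℕ) [Fact p.Prime]

/-- H3 of the crux verbatim: `ρ` is pro-modular of some tame level. -/
def ProMod (ρ : FramedGaloisRep F (PadicAlgCl p) 2) : Prop :=
  ∃ 𝒰 : TameLevel 2 F p, 𝒰.IsPadicallyAutomorphic ρ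

/-- The crux's conclusion verbatim. -/
def CruxConclusion (hcpt : isCompact_glFiniteIntegralLevel 2 F) (ι : PadicAlgCl p ≃+* ℂ)
    (ρ : FramedGaloisRep F (PadicAlgCl p) 2) : Prop :=
  ∃ π : CuspidalAutomorphicRepData 2 F hcpt, π.1.IsLAlgebraic ∧
    ∀ᶠ v in cofinite, Summit.Langlands.SatakeFrobCompatibleAt ι π.1 ρ v

/-- **Torsion (residual) seed.** Some residual representation `τ` of `ρ : Γ_F → GL₂(ℚ̄_p)`, realised over a
DISCRETE field `k` of characteristic `p` receiving `ℤ̄_p/𝔪` along `ιk`, is associated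
(`TameLevel.IsAssociated`: unramified off `𝒰.bad` with `charpoly τ(Frob_v) = ψ(P_v)`) with a CONTINUOUS
`k`-valued eigensystem `ψ` of the completed-cohomology Hecke algebra `𝕋(𝒰)` of SOME tame level — i.e.
(`ψ` continuous into a discrete ring ⇔ `ker ψ` open) the mod-`p` eigensystem of `ρ` OCCURS in some
`H^i(X_{U_r}, ℤ/p^s)`: torsion residual automorphy of `ρ̄`, at unspecified level, weight and degree.
This is what `hpm` carries beyond Fontaine–Mazur (Disproof §0 / NegativeNotes B0 notwithstanding: modulo
big `R = 𝕋` the pro-modularity hypothesis is EQUIVALENT to it). -/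
def HasTorsionSeed (ρ : FramedGaloisRep F (PadicAlgCl p) 2) : Prop :=
  ∃ (𝒰 : TameLevel 2 F p) (k : Type) (_ : Field k) (_ : TopologicalSpace k) (_ : DiscreteTopology k)
    (_ : CharP k p) (ιk : padicAlgClResidueField p →+* k) (ψ : CompletedCohomologyHeckeAlgebraGLn 𝒰 →+* k)
    (τ : FramedGaloisRep F k 2),
    Continuous ψ ∧ 𝒰.IsAssociated ψ τ ∧ ρ.IsResidualRepOf ιk (τ : absoluteGaloisGroup F →* GL (Fin 2) k)

/-- **S1 (formal, any number field): pro-modular ⇒ torsion seed.** The point `x : 𝕋(𝒰) → ℚ̄_p` of `hpm`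
is continuous, `𝔪_x = x⁻¹{|a| < 1}` is an OPEN prime, hence contains the kernel of `𝕋(𝒰) → 𝕋_J` for a finite
set `J` of indices `(r,s,i)`; `𝕋_J` acts faithfully on the FINITE (Borel–Serre: route crux #7
`BianchiCongruenceCohomologyFinite` for `F` imaginary quadratic; Borel–Serre/Raghunathan in general)
module `⊕_J H^i(X_{U_r}, ℤ/p^s)`, so `𝔪_x ∈ Supp`, and the `𝔪_x`-eigensystem `ψ` occurs; `τ := ` the
residual representation of `ρ` (exists in rank 2: `exists_semisimplification_fin_two`), whose Frobenius
characteristic polynomials are the reductions of `ρ`'s (`HasResidualCharpolys`), i.e. `ψ(P_v)`.  This is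
exactly the part of the tower/level-change that OPEN-CORE-c3 §2 certifies as FORMAL ("only the residual
eigensystem transfers formally"). [folklore; BorelSerre1973 Thm 11.4.4] -/
def TorsionSeedOfProMod : Prop :=
  ∀ (F : Type) [Field F] [NumberField F] (p : ℕ) [Fact p.Prime]
    (ρ : FramedGaloisRep F (PadicAlgCl p) 2), ProMod p ρ → HasTorsionSeed p ρ

/-- **S2 — THE LEVER: Smith-theoretic (Treumann–Venkatesh) ascent of torsion seeds along a cyclic extension
of degree EXACTLY `p`.**  For `F'/F` Galois with `[F' : F] = p` (prime = the coefficient characteristic;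
cyclic automatically), a torsion seed of `ρ` over `F` yields a torsion seed of `ρ|_{Γ_{F'}}` over `F'`.
CONTENT = TV, Ann. of Math. 183 (2016) 177–228, Thm 5 (First Main Theorem) for `𝐇 = GL₂/F` (or `SL₂/F` +
central-character bookkeeping — TV's own example, `F = ℚ(i)` included), `𝐆 = Res_{F'/F} GL₂`, `σ` a generator of
`Gal(F'/F)` (order `p`), `K ⊂ 𝐆(𝔸_F^∞)` `σ`-stable sufficiently small with `K^σ = U`: the mod-`p` eigensystem
`χ` on `[H]_U` transfers to `χ ∘ NBr` on `[G]_K = X^{GL₂/F'}_K` (Smith theory `Ĥ^*(σ; C^*(X)) ≅ Ĥ^*(σ; C^*(X^σ))`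
+ Brauer homomorphism), with Satake parameters at the `σ`-good places (all but finitely many) given by BASE
CHANGE (at a split `v = w₁⋯w_p`: the `T_{w_i}`-eigenvalues are the `p` roots of `X^p − χ(T_v)^p`, all equal to
`χ(T_v)`); Chebotarev + Brauer–Nesbitt + Scholze's determinant for `𝔪'` then give association with
`τ|_{Γ_{F'}}`.  NOT usual base change: no lift to characteristic `0` is used or produced (TV §1.2). The
coincidence `[F':F] = p = char k` is forced by Smith theory AND is what makes the final descent SOLVABLE.
[TreumannVenkatesh2016 Thm 5 + §1.2; Scholze2015 Cor V.4.3] -/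
def SmithAscentModP : Prop :=
  ∀ (F : Type) [Field F] [NumberField F] (p : ℕ) [Fact p.Prime]
    (F' : Type) [Field F'] [NumberField F'] [Algebra F F'] [IsGalois F F'],
    Module.finrank F F' = p →
    ∀ (ρ : FramedGaloisRep F (PadicAlgCl p) 2),
      HasTorsionSeed p ρ → HasTorsionSeed p (ρ.restrictField F')

/-! ### The regime in which the line closes the crux (typed on ONE residual representation `τ`) -/

variable {k : Type} [Field k]

/-- `τ|_{Γ_{F_v}}` is NOT split (not simultaneously diagonalisable on the decomposition group at `v`):
for a reducible `ρ̄|_{Γ_{F_v}}` this is "the extension class `∗ ≠ 0`" — then the set of Serre/crystalline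
weights of `ρ̄|_{Γ_{F_v}}` is a SINGLETON (Fontaine–Laffaille), so weight PRODUCTION is free by elimination. -/
def IsResiduallyNonsplitAt (τ : absoluteGaloisGroup F →* GL (Fin 2) k)
    (v : HeightOneSpectrum (𝓞 F)) : Prop :=
  ¬ ∃ P : GL (Fin 2) k, ∀ σ : absoluteGaloisGroup (v.adicCompletion F),
      (P⁻¹ * τ (absGaloisRestrict F (v.adicCompletion F) σ) * P).val 1 0 = 0 ∧
      (P⁻¹ * τ (absGaloisRestrict F (v.adicCompletion F) σ) * P).val 0 1 = 0

/-- The mod-`p` cyclotomic character of `Γ_{F_v}` pushed into `k` (a field of characteristic `p` in use):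
reduction of the tree's `p`-adic `cyclotomicCharacter` through `ℤ_p → ℤ/p → k`. -/
def omegaBar (v : HeightOneSpectrum (𝓞 F)) (σ : absoluteGaloisGroup (v.adicCompletion F)) : k :=
  ZMod.cast (R := k)
    (PadicInt.toZMod ((GaloisRep.cyclotomicCharacter (v.adicCompletion F) p σ).val : ℤ_[p]) : ZMod p)

/-- **Ramification-genericity at `v ∤ p`** (the hypothesis that replaces Taylor's Ihara avoidance, which the
line cannot reach): `H⁰(Γ_{F_v}, ad⁰ τ ⊗ ω̄) = 0` — no non-zero trace-zero `M` with `τ(σ) M τ(σ)⁻¹ = ω̄(σ)⁻¹ M`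
— so the UNRESTRICTED local lifting ring at `v` is formally smooth (a domain) and Calegari–Geraghty patching
with a TORSION seed needs no characteristic-`0` point on any local component. -/
def IsRamificationGenericAt (τ : absoluteGaloisGroup F →* GL (Fin 2) k)
    (v : HeightOneSpectrum (𝓞 F)) : Prop :=
  ∀ M : Matrix (Fin 2) (Fin 2) k, M.trace = 0 →
    (∀ σ : absoluteGaloisGroup (v.adicCompletion F),
      ((τ (absGaloisRestrict F (v.adicCompletion F) σ) : GL (Fin 2) k) : Matrix (Fin 2) (Fin 2) k) * M =
        (omegaBar (k := k) p v σ) • (M * ((τ (absGaloisRestrict F (v.adicCompletion F) σ) : GL (Fin 2) k) :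
          Matrix (Fin 2) (Fin 2) k))) → M = 0

/-- **The generic crystalline regime** of the line, all on ONE residual representation `τ : Γ_F → GL₂(ℤ̄_p/𝔪)` of
`ρ` (ACC+ Thm 6.1.1 (iii)–(iv) verbatim, as in the dead line `ordinary-patching-by-regime`'s `EnormousRegime`):
`τ` absolutely irreducible, decomposed generic, enormous on `Γ_{F(ζ_p)}`, a scalar `τ(σ)` off `Γ_{F(ζ_p)}`; PLUS
the two hypotheses specific to the Smith-ascent line: `τ` NON-SPLIT at every `v ∣ p` and ramification-generic
at every `v ∤ p` where `ρ` ramifies OR where `F/ℚ` ramifies (those places are forced into the bad set `S` over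
`F' = F·L` by the `T`-condition of Scholze/ACC+ Thm 2.3.5 — `F` is the only imaginary quadratic subfield of `F'` and a
prime ramified in `F` does not split in it — and carry the unrestricted fixed-determinant condition, smooth iff
`H⁰(ad⁰ τ ⊗ ω̄) = 0`); `p ≥ 5` splits completely in `F`. -/
def GenericCrystallineRegime (ρ : FramedGaloisRep F (PadicAlgCl p) 2) : Prop :=
  5 ≤ p ∧ SplitsCompletely F p ∧
  ∃ τ : absoluteGaloisGroup F →* GL (Fin 2) (padicAlgClResidueField p),
    ρ.IsResidualRepOf (RingHom.id _) τ ∧ IsAbsIrreducible τ ∧ IsDecomposedGeneric τ ∧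
      IsAbsIrreducible (τ.comp (absGaloisGroupAdjoinRootsOfUnity F p).subtype) ∧
      Subgroup.IsEnormous ((absGaloisGroupAdjoinRootsOfUnity F p).map τ) ∧
      (∃ σ : absoluteGaloisGroup F, σ ∉ absGaloisGroupAdjoinRootsOfUnity F p ∧
        ∃ c : padicAlgClResidueField p,
          ((τ σ : GL (Fin 2) (padicAlgClResidueField p)) :
            Matrix (Fin 2) (Fin 2) (padicAlgClResidueField p)) =
            c • (1 : Matrix (Fin 2) (Fin 2) (padicAlgClResidueField p))) ∧
      (∀ v : HeightOneSpectrum (𝓞 F), (p : 𝓞 F) ∈ v.asIdeal → IsResiduallyNonsplitAt τ v) ∧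
      (∀ v : HeightOneSpectrum (𝓞 F), (p : 𝓞 F) ∉ v.asIdeal →
        (¬ ρ.IsUnramifiedAt v ∨ ¬ Algebra.IsUnramifiedIn (𝓞 F) (v.asIdeal.under ℤ)) →
        IsRamificationGenericAt p τ v)

/-- **What the line proves (the crux on the generic crystalline regime).** Crux binders verbatim, `hpm`
verbatim, ordinarity with exponent `m = 1` and `k ≥ 3` (then "ordinary of weight `k`" = CRYSTALLINE ordinary with
Hodge–Tate weights `{0, k-1}`: for `k - 1 ≥ 2` every extension of the unramified quotient by `ε^{k-1}·unr`
is crystalline, `H¹_f = H¹`; `k = 2` would also admit Tate-curve-type semistable classes) and `2k < p` (ACC+ Thm 6.1.1's Fontaine–Laffaille window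
`λ_{τ,1} + λ_{τc,1} < p − 2n` for `λ = (k−2, 0)`; CN23 Rem 5.2.3 predicts `k ≤ p − 1`), in the regime above
⟹ the crux's conclusion.  Chain: S1 torsion seed over `F` → S2 Smith ascent to `F' = F·L` (`L/ℚ` cyclic of
degree `p`, `p` split completely in `L`, `L ∩ F(ρ̄, ζ_p) = ℚ`) → weight elimination over `F'` (CN23 Thm 4.2.15
(cr), available because `F'⁺ = L` has `p ≥ 5` places above `p`) + singleton crystalline weight of a NON-SPLIT
`ρ̄|_{Γ_{F_v}}` ⟹ `𝔪'` occurs in weight `λ` at hyperspecial level → Fontaine–Laffaille `R = 𝕋 ⇒ automorphy`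
over `F'` with the TORSION seed (ACC+ Cor 6.5.4 re-run: hardest stub) → cyclic prime-degree descent
(Arthur–Clozel) + Galois matching (HLTT). -/
def SmithAscentClassical : Prop :=
  ∀ (F : Type) [Field F] [NumberField F], IsTotallyComplex F → Module.finrank ℚ F = 2 →
    ∀ (p : ℕ) [Fact p.Prime], p ≠ 2 →
    ∀ (hcpt : isCompact_glFiniteIntegralLevel 2 F) (ι : PadicAlgCl p ≃+* ℂ)
      (ρ : FramedGaloisRep F (PadicAlgCl p) 2),
      ρ.toGaloisRep.IsIrreducible → (∀ᶠ v in cofinite, ρ.IsUnramifiedAt v) →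
      ProMod p ρ →
      (∃ k : ℕ, 3 ≤ k ∧ 2 * k < p ∧ ∀ v : HeightOneSpectrum (𝓞 F), (p : 𝓞 F) ∈ v.asIdeal →
          ρ.IsOrdinaryOfWeightAt p v k 1) →
      GenericCrystallineRegime p ρ →
      CruxConclusion p hcpt ι ρ

/-- Costume check in the honest direction: the regime statement is VERBATIM a specialisation of the crux
(`m = 1 > 0`; the regime hypothesis is simply dropped). -/
theorem smithAscentClassical_of_crux (h : ProModularOrdinaryClassical) : SmithAscentClassical := by
  intro F _ _ hF hdeg p _ hp hcpt ι ρ hirr hunr hpm hord _hreg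
  obtain ⟨k, hk, -, hv⟩ := hord
  exact h F hF hdeg p hp hcpt ι ρ hirr hunr hpm ⟨k, by omega, 1, Nat.one_pos, hv⟩

/-- The complement that a crux-plan skeleton would have to carry for `_of` to conclude the crux BY NAME
(`m ≠ 1` / `2k ≥ p` / outside the regime): recorded as a `Prop`, NOT claimed by this idea. -/
def ComplementRegime : Prop :=
  ∀ (F : Type) [Field F] [NumberField F], IsTotallyComplex F → Module.finrank ℚ F = 2 →
    ∀ (p : ℕ) [Fact p.Prime], p ≠ 2 →
    ∀ (hcpt : isCompact_glFiniteIntegralLevel 2 F) (ι : PadicAlgCl p ≃+* ℂ)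
      (ρ : FramedGaloisRep F (PadicAlgCl p) 2),
      ρ.toGaloisRep.IsIrreducible → (∀ᶠ v in cofinite, ρ.IsUnramifiedAt v) →
      ProMod p ρ →
      (∃ k : ℕ, 2 ≤ k ∧ ∃ m : ℕ, 0 < m ∧ ∀ v : HeightOneSpectrum (𝓞 F), (p : 𝓞 F) ∈ v.asIdeal →
          ρ.IsOrdinaryOfWeightAt p v k m) →
      ¬ ((∃ k : ℕ, 3 ≤ k ∧ 2 * k < p ∧ ∀ v : HeightOneSpectrum (𝓞 F), (p : 𝓞 F) ∈ v.asIdeal →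
          ρ.IsOrdinaryOfWeightAt p v k 1) ∧ GenericCrystallineRegime p ρ) →
      CruxConclusion p hcpt ι ρ

/-- Pure logic: regime theorem + complement ⇒ the crux by name (the shape a skeleton `_of` would take). -/
theorem crux_of_regime_and_complement (h₁ : SmithAscentClassical) (h₂ : ComplementRegime) :
    ProModularOrdinaryClassical := by
  intro F _ _ hF hdeg p _ hp hcpt ι ρ hirr hunr hpm hord
  by_cases hc : (∃ k : ℕ, 3 ≤ k ∧ 2 * k < p ∧ ∀ v : HeightOneSpectrum (𝓞 F), (p : 𝓞 F) ∈ v.asIdeal →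
      ρ.IsOrdinaryOfWeightAt p v k 1) ∧ GenericCrystallineRegime p ρ
  · exact h₁ F hF hdeg p hp hcpt ι ρ hirr hunr hpm hc.1 hc.2
  · exact h₂ F hF hdeg p hp hcpt ι ρ hirr hunr hpm hord hc

end

end Summit.Langlands.Langlands.Cruxes.ProModularOrdinaryClassical.SmithAscent
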